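import Literature.Analysis.OperatorTheory.CompactPositiveEigenSequence
import HarnessLib

/-!
# The subspace (Courant–Fischer) form of the min–max principle for compact positive operators

`Literature.Analysis.OperatorTheory.CompactPositiveMinMaxLevels` / `CompactPositiveEigenSequence`
construct, for a compact positive self-adjoint operator `T` on an infinite-dimensional Hilbert
space `G` (any `RCLike 𝕜`), an orthonormal eigen-sequence `e : ℕ → G`, `T e_k = ev_k e_k`, with
ANTITONE eigenvalues `ev_0 ≥ ev_1 ≥ ⋯ ≥ 0` and the domination property
`(∀ i < k, ⟪e_i, x⟫ = 0) → Re ⟪x, T x⟫ ≤ ev_k ‖x‖²`, and prove the CONSTRAINT form of min–max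
(`ev_k = min_{χ_1..χ_k} sup_{x ⊥ χ} Re⟪x,Tx⟫/‖x‖²`).  This file adds the SUBSPACE form
(Reed–Simon IV, Thm XIII.1, formulas (2a)/(2b) in its proof; Courant–Fischer):

* `isGreatest_subspace_rayleigh` — `ev_k = max {t | ∃ W, dim W = k + 1, t ‖x‖² ≤ Re ⟪x, T x⟫ on W}`
  (attained at `W = span (e_0, …, e_k)`);
* `isLUB_subspace_rayleigh_of_dense` — the same supremum when the trial subspaces `W` are
  restricted to lie in a DENSE subspace `D` (a form core; Reed–Simon IV, Thm XIII.2): `IsLUB`, in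
  general not attained.

For the energy form of a Schrödinger operator with compact resolvent this is, after the
substitution `K = (H + 1)⁻¹`, `t = (1 + s)⁻¹`, the statement
`μ_{k+1}(H) = inf_{dim W = k+1, W ⊆ core} max_{ψ ∈ W} 𝔮(ψ)/‖ψ‖²`
(see `Literature.Analysis.OperatorTheory.CompactEmbeddingFormLevels`).

## References
* [ReedSimonIV1978] M. Reed, B. Simon, *Methods of Modern Mathematical Physics IV*, §XIII.1,
  Thm XIII.1 (min–max; subspace form (2a)/(2b) in the proof) and Thm XIII.2 (form-core version),
  pp. 76–78 (held chunks p0083–p0084).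
-/

noncomputable section

open scoped InnerProductSpace ComplexConjugate BigOperators
open Filter _root_.Topology Finset

namespace Literature.Analysis.OperatorTheory

variable {𝕜 : Type*} [RCLike 𝕜] {G : Type*} [NormedAddCommGroup G] [InnerProductSpace 𝕜 G]

/-! ## 1. Finite-dimensional bookkeeping -/

/-- A `(k+1)`-dimensional subspace contains a nonzero vector orthogonal to any `k` given vectors
(dimension count). [cite: ReedSimonIV1978, Thm. XIII.1 (proof, (2b))] -/
theorem exists_mem_ne_zero_forall_inner_eq_zero {k : ℕ} (W : Submodule 𝕜 G)
    (hW : Module.finrank 𝕜 W = k + 1) (χ : Fin k → G) :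
    ∃ x ∈ W, x ≠ 0 ∧ ∀ l, ⟪χ l, x⟫_𝕜 = 0 := by
  haveI : Module.Finite 𝕜 W := Module.finite_of_finrank_eq_succ hW
  let L : W →ₗ[𝕜] (Fin k → 𝕜) :=
    { toFun := fun x l => ⟪χ l, (x : G)⟫_𝕜
      map_add' := fun x y => by funext l; simp [inner_add_right]
      map_smul' := fun a x => by funext l; simp [inner_smul_right] }
  have hker : LinearMap.ker L ≠ ⊥ := LinearMap.ker_ne_bot_of_finrank_lt (by simp [hW])
  obtain ⟨x, hxker, hx0⟩ := (Submodule.ne_bot_iff _).1 hker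
  refine ⟨x, x.2, fun h => hx0 (Subtype.ext h), fun l => ?_⟩
  exact congr_fun (LinearMap.mem_ker.1 hxker) l

/-- The coefficients of a vector in the span of an orthonormal family are bounded by its norm:
`‖c_i‖ ≤ ‖Σ c_j e_j‖`. [cite: ReedSimonIV1978, Thm. XIII.1 (proof)] -/
theorem norm_coeff_le_norm_sum {m : ℕ} {e : Fin m → G} (hon : Orthonormal 𝕜 e) (c : Fin m → 𝕜)
    (i : Fin m) : ‖c i‖ ≤ ‖∑ j, c j • e j‖ := by
  have h : ⟪e i, ∑ j, c j • e j⟫_𝕜 = c i := hon.inner_right_fintype c i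
  rw [← h]
  calc ‖⟪e i, ∑ j, c j • e j⟫_𝕜‖ ≤ ‖e i‖ * ‖∑ j, c j • e j‖ := norm_inner_le_norm _ _
    _ = ‖∑ j, c j • e j‖ := by rw [hon.1 i, one_mul]

/-- Second-order perturbation of the Rayleigh numerator:
`Re ⟪f, T f⟫ - ‖T‖ ‖h‖ (2‖f‖ + ‖h‖) ≤ Re ⟪f + h, T (f + h)⟫`. [cite: ReedSimonIV1978, Thm. XIII.2 (proof: continuity of the form on the core)] -/
theorem re_inner_sub_le_re_inner_add (T : G →L[𝕜] G) (f h : G) :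
    RCLike.re ⟪f, T f⟫_𝕜 - ‖T‖ * ‖h‖ * (2 * ‖f‖ + ‖h‖) ≤ RCLike.re ⟪f + h, T (f + h)⟫_𝕜 := by
  have hexp : ⟪f + h, T (f + h)⟫_𝕜 =
      ⟪f, T f⟫_𝕜 + (⟪h, T f⟫_𝕜 + (⟪f, T h⟫_𝕜 + ⟪h, T h⟫_𝕜)) := by
    rw [map_add, inner_add_right, inner_add_left, inner_add_left]; ring
  rw [hexp, map_add, map_add, map_add]
  have b1 : |RCLike.re ⟪h, T f⟫_𝕜| ≤ ‖h‖ * (‖T‖ * ‖f‖) :=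
    (RCLike.abs_re_le_norm _).trans ((norm_inner_le_norm _ _).trans
      (mul_le_mul_of_nonneg_left (T.le_opNorm f) (norm_nonneg _)))
  have b2 : |RCLike.re ⟪f, T h⟫_𝕜| ≤ ‖f‖ * (‖T‖ * ‖h‖) :=
    (RCLike.abs_re_le_norm _).trans ((norm_inner_le_norm _ _).trans
      (mul_le_mul_of_nonneg_left (T.le_opNorm h) (norm_nonneg _)))
  have b3 : |RCLike.re ⟪h, T h⟫_𝕜| ≤ ‖h‖ * (‖T‖ * ‖h‖) :=
    (RCLike.abs_re_le_norm _).trans ((norm_inner_le_norm _ _).trans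
      (mul_le_mul_of_nonneg_left (T.le_opNorm h) (norm_nonneg _)))
  rw [abs_le] at b1 b2 b3
  nlinarith [b1.1, b2.1, b3.1]

/-! ## 2. The subspace form of max–min (all trial subspaces) -/

/-- ★ **Courant–Fischer, subspace form** (Reed–Simon IV, Thm XIII.1, (2a)/(2b)): for an orthonormal
eigen-sequence `e` of `T` with antitone eigenvalues `ev` dominating the Rayleigh quotient off the
first `k` eigenvectors, `ev_k` is the GREATEST `t` for which some `(k+1)`-dimensional subspace `W`
has `t ‖x‖² ≤ Re ⟪x, T x⟫` for all `x ∈ W` — attained at `W = span (e_0, …, e_k)`.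
[cite: ReedSimonIV1978, Thm. XIII.1 (min–max principle, subspace form (2a)–(2b) of the proof)] -/
theorem isGreatest_subspace_rayleigh {T : G →L[𝕜] G} {e : ℕ → G} {ev : ℕ → ℝ}
    (hon : Orthonormal 𝕜 e) (heig : ∀ k, T (e k) = ((ev k : ℝ) : 𝕜) • e k) (hanti : Antitone ev)
    (hdom : ∀ (k : ℕ) (x : G), (∀ i, i < k → ⟪e i, x⟫_𝕜 = 0) →
      RCLike.re ⟪x, T x⟫_𝕜 ≤ ev k * ‖x‖ ^ 2) (k : ℕ) :
    IsGreatest {t : ℝ | ∃ W : Submodule 𝕜 G, Module.finrank 𝕜 W = k + 1 ∧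
      ∀ x ∈ W, t * ‖x‖ ^ 2 ≤ RCLike.re ⟪x, T x⟫_𝕜} (ev k) := by
  have hon' : Orthonormal 𝕜 (fun i : Fin (k + 1) => e i) := hon.comp _ Fin.val_injective
  have heig' : ∀ j : Fin (k + 1), T (e j) = ((ev j : ℝ) : 𝕜) • e j := fun j => heig j
  constructor
  · -- attained at the span of the first `k + 1` eigenvectors
    refine ⟨Submodule.span 𝕜 (Set.range fun i : Fin (k + 1) => e i), ?_, ?_⟩
    · rw [finrank_span_eq_card hon'.linearIndependent, Fintype.card_fin]
    · intro x hx
      obtain ⟨c, rfl⟩ := (Submodule.mem_span_range_iff_exists_fun 𝕜).1 hx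
      exact le_re_inner_of_orthonormal hon' heig' (s := ev k)
        (fun j => hanti (Nat.lt_succ_iff.1 j.isLt)) c
  · -- upper bound: a `(k+1)`-dimensional `W` meets `{e_0, …, e_{k-1}}^⊥` nontrivially
    rintro t ⟨W, hW, hWt⟩
    obtain ⟨x, hxW, hx0, hxorth⟩ :=
      exists_mem_ne_zero_forall_inner_eq_zero W hW (fun l : Fin k => e l)
    have h1 := hWt x hxW
    have h2 : RCLike.re ⟪x, T x⟫_𝕜 ≤ ev k * ‖x‖ ^ 2 :=
      hdom k x fun i hi => hxorth ⟨i, hi⟩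
    have hx2 : 0 < ‖x‖ ^ 2 := pow_pos (norm_pos_iff.2 hx0) 2
    exact le_of_mul_le_mul_right (h1.trans h2) hx2

/-! ## 3. The subspace form over a dense core -/

/-- ★★ **Courant–Fischer over a dense core** (Reed–Simon IV, Thm XIII.2 with Thm XIII.1 (2a)/(2b)):
under the hypotheses of `isGreatest_subspace_rayleigh` and positivity of `T`, if `D` is a dense
subspace then `ev_k` is the SUPREMUM of the `t` for which some `(k+1)`-dimensional `W ⊆ D` has
`t ‖x‖² ≤ Re ⟪x, T x⟫` on `W` (approximate `e_0, …, e_k` from `D`; the perturbed span is still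
`(k+1)`-dimensional and its Rayleigh quotient is off by `O(‖e_i - d_i‖)`).
[cite: ReedSimonIV1978, Thm. XIII.2 (min–max over a form core) and Thm. XIII.1 ((2a)–(2b))] -/
theorem isLUB_subspace_rayleigh_of_dense {T : G →L[𝕜] G}
    (hpos : ∀ x : G, 0 ≤ RCLike.re ⟪x, T x⟫_𝕜) {e : ℕ → G} {ev : ℕ → ℝ}
    (hon : Orthonormal 𝕜 e) (heig : ∀ k, T (e k) = ((ev k : ℝ) : 𝕜) • e k) (hanti : Antitone ev)
    (hdom : ∀ (k : ℕ) (x : G), (∀ i, i < k → ⟪e i, x⟫_𝕜 = 0) →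
      RCLike.re ⟪x, T x⟫_𝕜 ≤ ev k * ‖x‖ ^ 2)
    (D : Submodule 𝕜 G) (hD : Dense (D : Set G)) (k : ℕ) :
    IsLUB {t : ℝ | ∃ W : Submodule 𝕜 G, Module.finrank 𝕜 W = k + 1 ∧ W ≤ D ∧
      ∀ x ∈ W, t * ‖x‖ ^ 2 ≤ RCLike.re ⟪x, T x⟫_𝕜} (ev k) := by
  have hon' : Orthonormal 𝕜 (fun i : Fin (k + 1) => e i) := hon.comp _ Fin.val_injective
  have heig' : ∀ j : Fin (k + 1), T (e j) = ((ev j : ℝ) : 𝕜) • e j := fun j => heig j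
  have hevk : 0 ≤ ev k := ev_seq_nonneg hpos hon heig k
  -- (1) `ev k` is an upper bound (as in `isGreatest_subspace_rayleigh`)
  have hub : ∀ t ∈ {t : ℝ | ∃ W : Submodule 𝕜 G, Module.finrank 𝕜 W = k + 1 ∧ W ≤ D ∧
      ∀ x ∈ W, t * ‖x‖ ^ 2 ≤ RCLike.re ⟪x, T x⟫_𝕜}, t ≤ ev k := by
    rintro t ⟨W, hW, -, hWt⟩
    exact (isGreatest_subspace_rayleigh hon heig hanti hdom k).2 ⟨W, hW, hWt⟩
  -- (2) every `ev k - ε` is attained inside `D`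
  have happrox : ∀ ε : ℝ, 0 < ε → ∃ W : Submodule 𝕜 G, Module.finrank 𝕜 W = k + 1 ∧ W ≤ D ∧
      ∀ x ∈ W, (ev k - ε) * ‖x‖ ^ 2 ≤ RCLike.re ⟪x, T x⟫_𝕜 := by
    intro ε hε
    -- the approximation scale
    set C₀ : ℝ := ‖T‖ + ev k with hC₀
    have hC₀0 : 0 ≤ C₀ := by positivity
    set η : ℝ := min (1 / 2) (ε / (12 * C₀ + 4)) with hη
    have hη0 : 0 < η := lt_min (by norm_num) (by positivity)
    have hη2 : η ≤ 1 / 2 := min_le_left _ _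
    have hηε : 12 * C₀ * η ≤ ε := by
      have h1 : η ≤ ε / (12 * C₀ + 4) := min_le_right _ _
      rw [le_div_iff₀ (by positivity)] at h1
      nlinarith
    -- approximants `d i ∈ D` of the `e i`
    have hδ : 0 < η / (k + 1) := by positivity
    have hex : ∀ i : Fin (k + 1), ∃ d : G, d ∈ D ∧ ‖d - e i‖ ≤ η / (k + 1) := by
      intro i
      obtain ⟨d, hd, hdD⟩ := Metric.dense_iff.1 hD (e i) _ hδ
      refine ⟨d, hdD, ?_⟩
      rw [Metric.mem_ball, dist_eq_norm] at hd
      exact hd.le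
    choose d hdD hde using hex
    -- the perturbation estimate `‖Σ cᵢ dᵢ - Σ cᵢ eᵢ‖ ≤ η ‖Σ cᵢ eᵢ‖`
    have hpert : ∀ c : Fin (k + 1) → 𝕜,
        ‖∑ i, c i • d i - ∑ i, c i • e i‖ ≤ η * ‖∑ i, c i • e i‖ := by
      intro c
      rw [← Finset.sum_sub_distrib]
      calc ‖∑ i, (c i • d i - c i • e i)‖ ≤ ∑ i, ‖c i • d i - c i • e i‖ := norm_sum_le _ _
        _ ≤ ∑ _i : Fin (k + 1), ‖∑ j, c j • e j‖ * (η / (k + 1)) := by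
            refine Finset.sum_le_sum fun i _ => ?_
            rw [← smul_sub, norm_smul]
            exact mul_le_mul (norm_coeff_le_norm_sum hon' c i) (hde i) (norm_nonneg _)
              (norm_nonneg _)
        _ = η * ‖∑ i, c i • e i‖ := by
            rw [Finset.sum_const, Finset.card_univ, Fintype.card_fin, nsmul_eq_mul, Nat.cast_succ]
            have hk : (k : ℝ) + 1 ≠ 0 := by positivity
            field_simp
    -- the `d i` are linearly independent
    have hli : LinearIndependent 𝕜 d := by
      rw [Fintype.linearIndependent_iff]
      intro c hc
      have h1 := hpert c
      rw [hc, zero_sub, norm_neg] at h1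
      have h2 : ‖∑ i, c i • e i‖ = 0 := by
        nlinarith [norm_nonneg (∑ i, c i • e i)]
      rw [norm_eq_zero] at h2
      exact fun i => (Fintype.linearIndependent_iff.1 hon'.linearIndependent c h2) i
    refine ⟨Submodule.span 𝕜 (Set.range d), ?_, ?_, ?_⟩
    · rw [finrank_span_eq_card hli, Fintype.card_fin]
    · exact Submodule.span_le.2 (Set.range_subset_iff.2 hdD)
    · intro x hx
      obtain ⟨c, rfl⟩ := (Submodule.mem_span_range_iff_exists_fun 𝕜).1 hx
      -- notation: `f = Σ c e`, `f' = Σ c d = f + h`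
      set f : G := ∑ i, c i • e i with hf
      set f' : G := ∑ i, c i • d i with hf'
      have hh : ‖f' - f‖ ≤ η * ‖f‖ := hpert c
      have hfT : ev k * ‖f‖ ^ 2 ≤ RCLike.re ⟪f, T f⟫_𝕜 :=
        le_re_inner_of_orthonormal hon' heig' (s := ev k)
          (fun j => hanti (Nat.lt_succ_iff.1 j.isLt)) c
      -- the perturbation bound for the Rayleigh numerator
      have key := re_inner_sub_le_re_inner_add T f (f' - f)
      have e1 : f + (f' - f) = f' := by abel
      rw [e1] at key
      -- real-variable bookkeeping
      have ha := norm_nonneg f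
      have hb := norm_nonneg (f' - f)
      have hTn := norm_nonneg T
      have hp_le : ‖f'‖ ≤ ‖f‖ + ‖f' - f‖ := by
        calc ‖f'‖ = ‖f + (f' - f)‖ := by rw [e1]
          _ ≤ ‖f‖ + ‖f' - f‖ := norm_add_le _ _
      have hp_ge : ‖f‖ - ‖f' - f‖ ≤ ‖f'‖ := by
        have h1 : ‖f‖ ≤ ‖f'‖ + ‖f' - f‖ :=
          calc ‖f‖ = ‖f' - (f' - f)‖ := by rw [sub_sub_cancel]
            _ ≤ ‖f'‖ + ‖f' - f‖ := norm_sub_le _ _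
        linarith
      have hba : ‖f' - f‖ ≤ η * ‖f‖ := hh
      have hb2 : ‖f' - f‖ ≤ ‖f‖ / 2 := by nlinarith
      -- (i) the numerator perturbation is `≤ 3 ‖T‖ η ‖f‖²`
      have h_i : ‖T‖ * ‖f' - f‖ * (2 * ‖f‖ + ‖f' - f‖) ≤ 3 * ‖T‖ * η * ‖f‖ ^ 2 := by
        calc ‖T‖ * ‖f' - f‖ * (2 * ‖f‖ + ‖f' - f‖)
            ≤ ‖T‖ * (η * ‖f‖) * (2 * ‖f‖ + ‖f‖ / 2) :=
              mul_le_mul (mul_le_mul_of_nonneg_left hba hTn) (by linarith) (by positivity)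
                (by positivity)
          _ = (5 / 2) * ‖T‖ * η * ‖f‖ ^ 2 := by ring
          _ ≤ 3 * ‖T‖ * η * ‖f‖ ^ 2 := by
              have : 0 ≤ ‖T‖ * η * ‖f‖ ^ 2 := by positivity
              nlinarith
      -- (ii) `ev_k ‖f'‖² ≤ ev_k (1 + 3η) ‖f‖²`
      have h_ii : ev k * ‖f'‖ ^ 2 ≤ ev k * ‖f‖ ^ 2 + 3 * ev k * η * ‖f‖ ^ 2 := by
        have h1 : ‖f'‖ ^ 2 ≤ (‖f‖ + η * ‖f‖) ^ 2 :=
          pow_le_pow_left₀ (norm_nonneg _) (hp_le.trans (by linarith)) 2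
        have h2 : (‖f‖ + η * ‖f‖) ^ 2 ≤ ‖f‖ ^ 2 + 3 * η * ‖f‖ ^ 2 := by
          have : η ^ 2 ≤ η := by nlinarith
          nlinarith [sq_nonneg ‖f‖]
        have h3 := mul_le_mul_of_nonneg_left (h1.trans h2) hevk
        linarith
      -- (iii) `ε ‖f'‖² ≥ ε ‖f‖² / 4`
      have h_iii : ε * ‖f‖ ^ 2 / 4 ≤ ε * ‖f'‖ ^ 2 := by
        have h0 : 0 ≤ ‖f‖ / 2 := by positivity
        have h1 : ‖f‖ / 2 ≤ ‖f'‖ := by linarith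
        have h2 : (‖f‖ / 2) ^ 2 ≤ ‖f'‖ ^ 2 := pow_le_pow_left₀ h0 h1 2
        nlinarith
      -- (iv) the choice of `η`
      have h_iv : 12 * (‖T‖ + ev k) * η * ‖f‖ ^ 2 ≤ ε * ‖f‖ ^ 2 :=
        mul_le_mul_of_nonneg_right hηε (sq_nonneg _)
      have hgoal : (ev k - ε) * ‖f'‖ ^ 2 = ev k * ‖f'‖ ^ 2 - ε * ‖f'‖ ^ 2 := by ring
      rw [hgoal]
      linarith
  -- (3) conclusion
  refine ⟨hub, fun b hb => ?_⟩
  refine le_of_forall_pos_le_add fun ε hε => ?_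
  obtain ⟨W, hW, hWD, hWt⟩ := happrox ε hε
  have := hb ⟨W, hW, hWD, hWt⟩
  linarith

end Literature.Analysis.OperatorTheory

end
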